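import Literature.Analysis.Calculus.ConePoincareHomotopy
import HarnessLib

/-!
# The linear-homotopy (relative Poincaré) operator for 2-forms: contraction onto `range P`

Topic `Analysis/Calculus`; namespace `Literature.Analysis.Calculus`.  Definitions with bodies and
theorems; no named fact, no `sorry`.  Companion of `ConePoincareHomotopy.lean` (the cone over a
POINT); here the cone is over the image of a continuous linear map `P : E →L E` (a projection onto
an "axis" in the applications), through the LINEAR homotopy

  `h_t(y) = P y + t (y - P y) = conePt (P y) y t`,   `D h_t = P + t (1 - P)`   (`axisDiff`),

and the associated operator on `2`-forms `τ : E → E [⋀^Fin 2]→L[ℝ] F`,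

  `(K τ)(y)(w) = ∫₀¹ τ(h_t y) (y - P y, P w + t (w - P w)) dt`                (`axisPrimitive`)

written as `(∫₀¹ τ(h_t y).curryLeft (y - P y) dt) ∘ P + (conePrimitive (P y) τ y) ∘ (1 - P)`
(`axisIntegralA`, Mathlib/tree `conePrimitive` with the moving base point `P y`).  This file
provides the analysis of `K`: evaluation (`axisPrimitive_apply`), the sup bound
`‖(K τ)(y)‖ ≤ (‖P‖ + ‖1 - P‖) ‖y - P y‖ sup_{[P y, y]} ‖τ‖` (`norm_axisPrimitive_le`) — so `K τ`
vanishes to SECOND order at `range P` when `τ` vanishes to first order —, invariance under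
translations `p` with `P p = p` (`axisPrimitive_add_of_forall`), and differentiability under the
integral sign with the explicit derivative integrands (`hasFDerivAt_axisIntegralA`,
`hasFDerivAt_conePrimitive_base`).  The homotopy formula `d(K τ) = τ - h₀* τ` for closed `τ` is
`AxisPoincareHomotopyFormula.lean`.  This is the relative Poincaré lemma along a submanifold in its
simplest (linear) form (Bott–Tu 1982, I §4 and §6, "Poincaré lemma for a vector bundle": integration
along the fibre of the linear contraction; Spivak 1965, Thm. 4-11), used for the normal form of
near-symplectic forms along their zero circles (`Literature/Geometry/Symplectic`: the primitive
`η = K(Θ_A - ω)` vanishing to second order along the circle).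

## References

* R. Bott, L. W. Tu, *Differential Forms in Algebraic Topology*, GTM 82 (1982), I §4, §6. [BottTu1982]
* M. Spivak, *Calculus on Manifolds*, Benjamin (1965), Thm. 4-11. [Spivak1965]
-/

noncomputable section

open Set MeasureTheory intervalIntegral Filter Topology
open scoped Interval

namespace Literature.Analysis.Calculus

variable {E F : Type*} [NormedAddCommGroup E] [NormedSpace ℝ E] [NormedAddCommGroup F]
  [NormedSpace ℝ F]

/-! ### The linear homotopy and its differential -/

/-- The differential `D h_t = P + t (1 - P)` of the linear homotopy `h_t(y) = P y + t (y - P y)`.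
[folklore] -/
def axisDiff (P : E →L[ℝ] E) (t : ℝ) : E →L[ℝ] E := P + t • (ContinuousLinearMap.id ℝ E - P)

/-- Unfolding. [folklore] -/
theorem axisDiff_apply (P : E →L[ℝ] E) (t : ℝ) (v : E) : axisDiff P t v = P v + t • (v - P v) := by
  simp [axisDiff]

/-- The linear homotopy is `conePt` with base point `P y`, and is linear in `y`:
`conePt (P y) y t = (P + t(1 - P)) y`. [folklore] -/
theorem conePt_base_eq_axisDiff (P : E →L[ℝ] E) (y : E) (t : ℝ) :
    conePt (P y) y t = axisDiff P t y := by
  rw [conePt, axisDiff_apply]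

/-- At `t = 0` the differential is `P`. [folklore] -/
@[simp] theorem axisDiff_zero (P : E →L[ℝ] E) : axisDiff P 0 = P := by
  ext v; simp [axisDiff_apply]

/-- At `t = 1` the differential is the identity. [folklore] -/
@[simp] theorem axisDiff_one (P : E →L[ℝ] E) : axisDiff P 1 = ContinuousLinearMap.id ℝ E := by
  ext v; simp [axisDiff_apply]

/-- `t ↦ D h_t` is continuous (affine). [folklore] -/
theorem continuous_axisDiff (P : E →L[ℝ] E) : Continuous (axisDiff P) :=
  continuous_const.add (continuous_id.smul continuous_const)

/-- `‖D h_t‖ ≤ ‖P‖ + ‖1 - P‖` for `t ∈ [0, 1]`. [folklore] -/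
theorem norm_axisDiff_le (P : E →L[ℝ] E) {t : ℝ} (ht : t ∈ Icc (0 : ℝ) 1) :
    ‖axisDiff P t‖ ≤ ‖P‖ + ‖ContinuousLinearMap.id ℝ E - P‖ := by
  rw [axisDiff]
  refine (norm_add_le _ _).trans (add_le_add le_rfl ?_)
  rw [norm_smul, Real.norm_eq_abs, abs_of_nonneg ht.1]
  exact (mul_le_of_le_one_left (norm_nonneg _) ht.2)

/-- **The linear homotopy has derivative `D h_t` in `y`** (it is the continuous linear map
`P + t (1 - P)`). [folklore] -/
theorem hasFDerivAt_conePt_base (P : E →L[ℝ] E) (t : ℝ) (y : E) :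
    HasFDerivAt (fun z : E ↦ conePt (P z) z t) (axisDiff P t) y := by
  have h : (fun z : E ↦ conePt (P z) z t) = axisDiff P t := funext fun z ↦ conePt_base_eq_axisDiff P z t
  rw [h]
  exact (axisDiff P t).hasFDerivAt

/-- `y - P y` has derivative `1 - P`. [folklore] -/
theorem hasFDerivAt_sub_base (P : E →L[ℝ] E) (y : E) :
    HasFDerivAt (fun z : E ↦ z - P z) (ContinuousLinearMap.id ℝ E - P) y := by
  have h : (fun z : E ↦ z - P z) = (ContinuousLinearMap.id ℝ E - P) := by funext z; simp
  rw [h]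
  exact (ContinuousLinearMap.id ℝ E - P).hasFDerivAt

/-- Sets mapped into themselves by `P` are star-shaped about `P y` when convex. [folklore] -/
theorem starConvex_base {X : Set E} (hX : Convex ℝ X) {P : E →L[ℝ] E} (hP : ∀ y ∈ X, P y ∈ X)
    {y : E} (hy : y ∈ X) : StarConvex ℝ (P y) X :=
  hX.starConvex (hP y hy)

/-! ### Linearity of a `2`-form in its second slot -/

omit [NormedAddCommGroup F] [NormedSpace ℝ F] in
/-- `f(u, a + b) = f(u, a) + f(u, b)`. [folklore] -/
theorem apply_vecCons_add {F : Type*} [NormedAddCommGroup F] [NormedSpace ℝ F]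
    (f : E [⋀^Fin 2]→L[ℝ] F) (u a b : E) :
    f ![u, a + b] = f ![u, a] + f ![u, b] := by
  have h := (f.curryLeft u).toAlternatingMap.map_vecCons_add ![] a b
  simpa [ContinuousAlternatingMap.curryLeft_apply_apply] using h

omit [NormedAddCommGroup F] [NormedSpace ℝ F] in
/-- `f(u, c • a) = c • f(u, a)`. [folklore] -/
theorem apply_vecCons_smul {F : Type*} [NormedAddCommGroup F] [NormedSpace ℝ F]
    (f : E [⋀^Fin 2]→L[ℝ] F) (u : E) (c : ℝ) (a : E) :
    f ![u, c • a] = c • f ![u, a] := by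
  have h := (f.curryLeft u).toAlternatingMap.map_vecCons_smul ![] c a
  simpa [ContinuousAlternatingMap.curryLeft_apply_apply] using h

/-! ### The `P`-part of the operator -/

/-- `A(y) = ∫₀¹ τ(h_t y).curryLeft (y - P y) dt` (the part of the operator fed with `P w`).
[cite: BottTu1982, I §6] -/
def axisIntegralA (P : E →L[ℝ] E) (τ : E → E [⋀^Fin 2]→L[ℝ] F) (y : E) : E [⋀^Fin 1]→L[ℝ] F :=
  ∫ t in (0 : ℝ)..1, (τ (conePt (P y) y t)).curryLeft (y - P y)

variable [CompleteSpace F]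

omit [CompleteSpace F] in
/-- Continuity in `t` of the integrand of `A`. [folklore] -/
theorem continuousOn_integrandA {τ : E → E [⋀^Fin 2]→L[ℝ] F} {X : Set E} (hc : ContinuousOn τ X)
    {P : E →L[ℝ] E} {y : E} (hstar : StarConvex ℝ (P y) X) (hy : y ∈ X) :
    ContinuousOn (fun t : ℝ ↦ (τ (conePt (P y) y t)).curryLeft (y - P y)) (Icc 0 1) := by
  have h1 : ContinuousOn (fun t ↦ curryLeftCLM F 1 (τ (conePt (P y) y t)) (y - P y)) (Icc 0 1) :=
    ((curryLeftCLM F 1).continuous.comp_continuousOn (continuousOn_comp_conePt hc hstar hy)).clm_apply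
      continuousOn_const
  simpa using h1

omit [CompleteSpace F] in
/-- Interval integrability of the integrand of `A`. [folklore] -/
theorem intervalIntegrable_integrandA {τ : E → E [⋀^Fin 2]→L[ℝ] F} {X : Set E}
    (hc : ContinuousOn τ X) {P : E →L[ℝ] E} {y : E} (hstar : StarConvex ℝ (P y) X) (hy : y ∈ X) :
    IntervalIntegrable (fun t : ℝ ↦ (τ (conePt (P y) y t)).curryLeft (y - P y)) volume 0 1 := by
  refine ContinuousOn.intervalIntegrable ?_
  rw [uIcc_of_le zero_le_one]
  exact continuousOn_integrandA hc hstar hy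

/-- **Evaluation of `A`**: `A(y)(v) = ∫₀¹ τ(h_t y)(y - P y, v) dt`. [cite: BottTu1982, I §6] -/
theorem axisIntegralA_apply {τ : E → E [⋀^Fin 2]→L[ℝ] F} {X : Set E} (hc : ContinuousOn τ X)
    {P : E →L[ℝ] E} {y : E} (hstar : StarConvex ℝ (P y) X) (hy : y ∈ X) (v : Fin 1 → E) :
    axisIntegralA P τ y v =
      ∫ t in (0 : ℝ)..1, τ (conePt (P y) y t) (Matrix.vecCons (y - P y) v) := by
  unfold axisIntegralA
  rw [← ContinuousAlternatingMap.apply_apply (𝕜 := ℝ) (m := v) (c := ∫ t in (0 : ℝ)..1, _),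
    ← (ContinuousAlternatingMap.apply ℝ E F v).intervalIntegral_comp_comm
      (intervalIntegrable_integrandA hc hstar hy)]
  rfl

omit [CompleteSpace F] in
/-- **Sup bound for `A`**: `‖A(y)‖ ≤ C ‖y - P y‖` if `‖τ‖ ≤ C` on the segment `[P y, y]`. [folklore] -/
theorem norm_axisIntegralA_le {τ : E → E [⋀^Fin 2]→L[ℝ] F} {P : E →L[ℝ] E} {y : E} {C : ℝ}
    (hC : ∀ t ∈ Icc (0 : ℝ) 1, ‖τ (conePt (P y) y t)‖ ≤ C) :
    ‖axisIntegralA P τ y‖ ≤ C * ‖y - P y‖ := by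
  have h := intervalIntegral.norm_integral_le_of_norm_le_const (a := (0 : ℝ)) (b := 1)
    (C := C * ‖y - P y‖) (f := fun t : ℝ ↦ (τ (conePt (P y) y t)).curryLeft (y - P y)) ?_
  · simpa [axisIntegralA] using h
  · intro t ht
    rw [uIoc_of_le zero_le_one] at ht
    exact (norm_curryLeft_apply_le _ _).trans
      (mul_le_mul_of_nonneg_right (hC t ⟨ht.1.le, ht.2⟩) (norm_nonneg _))

/-! ### The operator -/

/-- **The linear-homotopy (relative Poincaré) operator** for `2`-forms:
`(K τ)(y)(w) = ∫₀¹ τ(h_t y)(y - P y, P w + t (w - P w)) dt`, assembled from `A` and the cone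
operator with base point `P y`. [cite: BottTu1982, I §6] -/
def axisPrimitive (P : E →L[ℝ] E) (τ : E → E [⋀^Fin 2]→L[ℝ] F) (y : E) : E [⋀^Fin 1]→L[ℝ] F :=
  (axisIntegralA P τ y).compContinuousLinearMap P +
    (conePrimitive (P y) τ y).compContinuousLinearMap (ContinuousLinearMap.id ℝ E - P)

/-- **Evaluation of the operator**: `(K τ)(y)(w) = ∫₀¹ τ(h_t y)(y - P y, D h_t w) dt`.
[cite: BottTu1982, I §6] -/
theorem axisPrimitive_apply {τ : E → E [⋀^Fin 2]→L[ℝ] F} {X : Set E} (hc : ContinuousOn τ X)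
    {P : E →L[ℝ] E} {y : E} (hstar : StarConvex ℝ (P y) X) (hy : y ∈ X) (v : Fin 1 → E) :
    axisPrimitive P τ y v =
      ∫ t in (0 : ℝ)..1, τ (conePt (P y) y t) ![y - P y, axisDiff P t (v 0)] := by
  have hcont : ∀ m : Fin 2 → E, ContinuousOn (fun t : ℝ ↦ τ (conePt (P y) y t) m) (Icc 0 1) :=
    fun m ↦ (ContinuousAlternatingMap.apply ℝ E F m).continuous.comp_continuousOn
      (continuousOn_comp_conePt hc hstar hy)
  have hint1 : IntervalIntegrable
      (fun t : ℝ ↦ τ (conePt (P y) y t) (Matrix.vecCons (y - P y) (⇑P ∘ v))) volume 0 1 :=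
    ContinuousOn.intervalIntegrable (by rw [uIcc_of_le zero_le_one]; exact hcont _)
  have hint2 : IntervalIntegrable (fun t : ℝ ↦ (t ^ 1) • τ (conePt (P y) y t)
      (Matrix.vecCons (y - P y) (⇑(ContinuousLinearMap.id ℝ E - P) ∘ v))) volume 0 1 :=
    ContinuousOn.intervalIntegrable (by
      rw [uIcc_of_le zero_le_one]; exact (continuousOn_pow 1).smul (hcont _))
  rw [axisPrimitive, ContinuousAlternatingMap.add_apply,
    ContinuousAlternatingMap.compContinuousLinearMap_apply,
    ContinuousAlternatingMap.compContinuousLinearMap_apply, axisIntegralA_apply hc hstar hy,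
    conePrimitive_apply hc hstar hy, ← integral_add hint1 hint2]
  refine integral_congr fun t _ ↦ ?_
  have h1 : Matrix.vecCons (y - P y) (⇑P ∘ v) = ![y - P y, P (v 0)] := by
    funext i; refine Fin.cases rfl (fun j ↦ ?_) i
    fin_cases j; rfl
  have h2 : Matrix.vecCons (y - P y) (⇑(ContinuousLinearMap.id ℝ E - P) ∘ v) =
      ![y - P y, v 0 - P (v 0)] := by
    funext i; refine Fin.cases rfl (fun j ↦ ?_) i
    fin_cases j; rfl
  simp only [h1, h2, pow_one, axisDiff_apply, apply_vecCons_add, apply_vecCons_smul]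

omit [CompleteSpace F] in
/-- `‖f ∘ g‖ ≤ ‖f‖ ‖g‖` for a `1`-form `f` and a continuous linear map `g`. [folklore] -/
theorem norm_compContinuousLinearMap_fin_one_le (f : E [⋀^Fin 1]→L[ℝ] F) (g : E →L[ℝ] E) :
    ‖f.compContinuousLinearMap g‖ ≤ ‖f‖ * ‖g‖ := by
  refine (f.compContinuousLinearMap g).opNorm_le_bound (by positivity) fun v ↦ ?_
  rw [ContinuousAlternatingMap.compContinuousLinearMap_apply, Fin.prod_univ_one]
  refine (f.le_opNorm _).trans ?_
  rw [Fin.prod_univ_one, Function.comp_apply, mul_assoc]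
  exact mul_le_mul_of_nonneg_left (g.le_opNorm _) (norm_nonneg _)

omit [CompleteSpace F] in
/-- **Sup bound for the operator**: `‖(K τ)(y)‖ ≤ (‖P‖ + ‖1 - P‖) · C · ‖y - P y‖` if `‖τ‖ ≤ C`
on the segment `[P y, y]` — `K τ` vanishes to second order at `range P` when `τ` vanishes to first
order there. [cite: BottTu1982, I §6] -/
theorem norm_axisPrimitive_le {τ : E → E [⋀^Fin 2]→L[ℝ] F} {P : E →L[ℝ] E} {y : E} {C : ℝ}
    (hC : ∀ t ∈ Icc (0 : ℝ) 1, ‖τ (conePt (P y) y t)‖ ≤ C) :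
    ‖axisPrimitive P τ y‖ ≤ (‖P‖ + ‖ContinuousLinearMap.id ℝ E - P‖) * (C * ‖y - P y‖) := by
  rw [axisPrimitive, add_mul]
  refine (norm_add_le _ _).trans (add_le_add ?_ ?_)
  · refine (norm_compContinuousLinearMap_fin_one_le _ _).trans ?_
    rw [mul_comm]
    exact mul_le_mul_of_nonneg_left (norm_axisIntegralA_le hC) (norm_nonneg _)
  · refine (norm_compContinuousLinearMap_fin_one_le _ _).trans ?_
    rw [mul_comm]
    exact mul_le_mul_of_nonneg_left (norm_conePrimitive_le hC) (norm_nonneg _)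

omit [CompleteSpace F] in
/-- **Translation invariance along the axis**: if `P p = p` and `τ` is `p`-periodic, then so is
`K τ` (`h_t(y + p) = h_t(y) + p`, `(y + p) - P(y + p) = y - P y`). [folklore] -/
theorem axisPrimitive_add_of_forall {τ : E → E [⋀^Fin 2]→L[ℝ] F} {P : E →L[ℝ] E} {p : E}
    (hp : P p = p) (hτ : ∀ x, τ (x + p) = τ x) (y : E) :
    axisPrimitive P τ (y + p) = axisPrimitive P τ y := by
  have h1 : y + p - (P y + p) = y - P y := add_sub_add_right_eq_sub y (P y) p
  have h2 : ∀ t, conePt (P y + p) (y + p) t = conePt (P y) y t + p := fun t ↦ by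
    simp only [conePt, h1]; abel
  have h3 : ∀ t, τ (conePt (P y + p) (y + p) t) = τ (conePt (P y) y t) := fun t ↦ by
    rw [h2, hτ]
  simp only [axisPrimitive, axisIntegralA, conePrimitive, map_add, hp, h1, h3]

/-! ### Differentiation under the integral sign -/

/-- The derivative integrand (parameter `y`, time `t`, weight `tᵏ`):
`w ↦ tᵏ · (τ(h_t y).curryLeft ((1 - P) w) + (Dτ(h_t y)(D h_t w)).curryLeft (y - P y))`. [folklore] -/
def axisDerivIntegrand (P : E →L[ℝ] E) (τ : E → E [⋀^Fin 2]→L[ℝ] F)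
    (τ' : E → E →L[ℝ] E [⋀^Fin 2]→L[ℝ] F) (y : E) (t : ℝ) (k : ℕ) :
    E →L[ℝ] E [⋀^Fin 1]→L[ℝ] F :=
  (t ^ k) • ((curryLeftCLM F 1).precompR E (τ (conePt (P y) y t)) (ContinuousLinearMap.id ℝ E - P) +
    (curryLeftCLM F 1).precompL E ((τ' (conePt (P y) y t)).comp (axisDiff P t)) (y - P y))

omit [CompleteSpace F] in
/-- The derivative integrand, evaluated. [folklore] -/
theorem axisDerivIntegrand_apply (P : E →L[ℝ] E) (τ : E → E [⋀^Fin 2]→L[ℝ] F)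
    (τ' : E → E →L[ℝ] E [⋀^Fin 2]→L[ℝ] F) (y : E) (t : ℝ) (k : ℕ) (w : E) :
    axisDerivIntegrand P τ τ' y t k w =
      (t ^ k) • ((τ (conePt (P y) y t)).curryLeft (w - P w) +
        (τ' (conePt (P y) y t) (axisDiff P t w)).curryLeft (y - P y)) := by
  simp only [axisDerivIntegrand, ContinuousLinearMap.precompR, ContinuousLinearMap.precompL,
    FunLike.coe_smul, FunLike.coe_add, Pi.smul_apply, Pi.add_apply, ContinuousLinearMap.flip_apply,
    ContinuousLinearMap.comp_apply, ContinuousLinearMap.compL_apply, curryLeftCLM_apply,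
    FunLike.coe_sub, Pi.sub_apply, ContinuousLinearMap.id_apply]

omit [CompleteSpace F] in
/-- The derivative integrand, doubly evaluated:
`tᵏ · (τ(h_t y)((1-P) w, m) + Dτ(h_t y)(D h_t w)(y - P y, m))`. [folklore] -/
theorem axisDerivIntegrand_apply_apply (P : E →L[ℝ] E) (τ : E → E [⋀^Fin 2]→L[ℝ] F)
    (τ' : E → E →L[ℝ] E [⋀^Fin 2]→L[ℝ] F) (y : E) (t : ℝ) (k : ℕ) (w : E) (m : Fin 1 → E) :
    axisDerivIntegrand P τ τ' y t k w m =
      (t ^ k) • (τ (conePt (P y) y t) (Matrix.vecCons (w - P w) m) +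
        τ' (conePt (P y) y t) (axisDiff P t w) (Matrix.vecCons (y - P y) m)) := by
  rw [axisDerivIntegrand_apply]
  simp only [ContinuousAlternatingMap.smul_apply, ContinuousAlternatingMap.add_apply,
    ContinuousAlternatingMap.curryLeft_apply_apply]

omit [CompleteSpace F] in
/-- Norm bound for the derivative integrand on `[0, 1]`:
`‖F'(y, t)‖ ≤ ‖τ(h_t y)‖ ‖1 - P‖ + ‖Dτ(h_t y)‖ (‖P‖ + ‖1 - P‖) ‖y - P y‖`. [folklore] -/
theorem norm_axisDerivIntegrand_le (P : E →L[ℝ] E) (τ : E → E [⋀^Fin 2]→L[ℝ] F)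
    (τ' : E → E →L[ℝ] E [⋀^Fin 2]→L[ℝ] F) (y : E) {t : ℝ} (ht : t ∈ Icc (0 : ℝ) 1) (k : ℕ) :
    ‖axisDerivIntegrand P τ τ' y t k‖ ≤
      ‖τ (conePt (P y) y t)‖ * ‖ContinuousLinearMap.id ℝ E - P‖ +
        ‖τ' (conePt (P y) y t)‖ * (‖P‖ + ‖ContinuousLinearMap.id ℝ E - P‖) * ‖y - P y‖ := by
  have hQ : ∀ w : E, ‖w - P w‖ ≤ ‖ContinuousLinearMap.id ℝ E - P‖ * ‖w‖ := fun w ↦ by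
    simpa using (ContinuousLinearMap.id ℝ E - P).le_opNorm w
  refine ContinuousLinearMap.opNorm_le_bound _ (by positivity) fun w ↦ ?_
  rw [axisDerivIntegrand_apply, norm_smul, norm_pow, Real.norm_eq_abs]
  have ht1 : |t| ^ k ≤ 1 := pow_le_one₀ (abs_nonneg t) (abs_le.2 ⟨by linarith [ht.1], ht.2⟩)
  have h1 : ‖(τ (conePt (P y) y t)).curryLeft (w - P w)‖ ≤
      ‖τ (conePt (P y) y t)‖ * ‖ContinuousLinearMap.id ℝ E - P‖ * ‖w‖ := by
    refine (norm_curryLeft_apply_le _ _).trans ?_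
    rw [mul_assoc]
    exact mul_le_mul_of_nonneg_left (hQ w) (norm_nonneg _)
  have h2 : ‖(τ' (conePt (P y) y t) (axisDiff P t w)).curryLeft (y - P y)‖ ≤
      ‖τ' (conePt (P y) y t)‖ * (‖P‖ + ‖ContinuousLinearMap.id ℝ E - P‖) * ‖y - P y‖ * ‖w‖ := by
    refine (norm_curryLeft_apply_le _ _).trans ?_
    have h3 : ‖τ' (conePt (P y) y t) (axisDiff P t w)‖ ≤
        ‖τ' (conePt (P y) y t)‖ * ((‖P‖ + ‖ContinuousLinearMap.id ℝ E - P‖) * ‖w‖) :=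
      (ContinuousLinearMap.le_opNorm _ _).trans (mul_le_mul_of_nonneg_left
        (((axisDiff P t).le_opNorm w).trans (mul_le_mul_of_nonneg_right (norm_axisDiff_le P ht)
          (norm_nonneg _))) (norm_nonneg _))
    calc ‖τ' (conePt (P y) y t) (axisDiff P t w)‖ * ‖y - P y‖
        ≤ ‖τ' (conePt (P y) y t)‖ * ((‖P‖ + ‖ContinuousLinearMap.id ℝ E - P‖) * ‖w‖) * ‖y - P y‖ :=
          mul_le_mul_of_nonneg_right h3 (norm_nonneg _)
      _ = _ := by ring
  calc |t| ^ k * ‖(τ (conePt (P y) y t)).curryLeft (w - P w) +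
        (τ' (conePt (P y) y t) (axisDiff P t w)).curryLeft (y - P y)‖
      ≤ 1 * (‖τ (conePt (P y) y t)‖ * ‖ContinuousLinearMap.id ℝ E - P‖ * ‖w‖ +
          ‖τ' (conePt (P y) y t)‖ * (‖P‖ + ‖ContinuousLinearMap.id ℝ E - P‖) * ‖y - P y‖ * ‖w‖) :=
        mul_le_mul ht1 ((norm_add_le _ _).trans (add_le_add h1 h2)) (norm_nonneg _) zero_le_one
    _ = _ := by ring

set_option maxHeartbeats 800000 in
omit [CompleteSpace F] in
/-- Pointwise derivative in the parameter of the integrands `tᵏ · τ(h_t y).curryLeft (y - P y)`.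
[folklore] -/
theorem hasFDerivAt_axisIntegrand {τ : E → E [⋀^Fin 2]→L[ℝ] F}
    {τ' : E → E →L[ℝ] E [⋀^Fin 2]→L[ℝ] F} {P : E →L[ℝ] E} {y : E} {t : ℝ}
    (h : HasFDerivAt τ (τ' (conePt (P y) y t)) (conePt (P y) y t)) (k : ℕ) :
    HasFDerivAt (fun z : E ↦ (t ^ k) • (τ (conePt (P z) z t)).curryLeft (z - P z))
      (axisDerivIntegrand P τ τ' y t k) y := by
  have h0 : HasFDerivAt (fun z : E ↦ τ (conePt (P z) z t))
      ((τ' (conePt (P y) y t)).comp (axisDiff P t)) y :=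
    HasFDerivAt.comp y h (hasFDerivAt_conePt_base P t y)
  exact ((curryLeftCLM F 1).hasFDerivAt_of_bilinear h0 (hasFDerivAt_sub_base P y)).const_smul (t ^ k)

omit [CompleteSpace F] in
/-- The derivative integrand through continuous linear maps of `t`:
`tᵏ · ((τ(h_t y)).curryLeft ∘ (1 - P) + (curryLeft(·)(y - P y)) ∘ Dτ(h_t y) ∘ D h_t)`. [folklore] -/
theorem axisDerivIntegrand_eq (P : E →L[ℝ] E) (τ : E → E [⋀^Fin 2]→L[ℝ] F)
    (τ' : E → E →L[ℝ] E [⋀^Fin 2]→L[ℝ] F) (y : E) (t : ℝ) (k : ℕ) :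
    axisDerivIntegrand P τ τ' y t k =
      (t ^ k) • ((curryLeftCLM F 1 (τ (conePt (P y) y t))).comp (ContinuousLinearMap.id ℝ E - P) +
        (((curryLeftCLM F 1).flip (y - P y)).comp
          ((τ' (conePt (P y) y t)).comp (axisDiff P t)))) := by
  ext w m
  rw [axisDerivIntegrand_apply_apply]
  simp only [FunLike.coe_smul, FunLike.coe_add, Pi.smul_apply, Pi.add_apply,
    ContinuousLinearMap.comp_apply, ContinuousLinearMap.flip_apply, curryLeftCLM_apply,
    ContinuousAlternatingMap.smul_apply, ContinuousAlternatingMap.add_apply,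
    ContinuousAlternatingMap.curryLeft_apply_apply, FunLike.coe_sub, Pi.sub_apply,
    ContinuousLinearMap.id_apply]

set_option maxHeartbeats 800000 in
omit [CompleteSpace F] in
/-- Continuity of the derivative integrand in `t` on `[0, 1]`. [folklore] -/
theorem continuousOn_axisDerivIntegrand {τ : E → E [⋀^Fin 2]→L[ℝ] F}
    {τ' : E → E →L[ℝ] E [⋀^Fin 2]→L[ℝ] F} {X : Set E} {P : E →L[ℝ] E} {y : E}
    (hstar : StarConvex ℝ (P y) X) (hy : y ∈ X) (hc : ContinuousOn τ X) (hc' : ContinuousOn τ' X)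
    (k : ℕ) :
    ContinuousOn (fun t : ℝ ↦ axisDerivIntegrand P τ τ' y t k) (Icc 0 1) := by
  have e : (fun t : ℝ ↦ axisDerivIntegrand P τ τ' y t k) = fun t : ℝ ↦
      (t ^ k) • ((curryLeftCLM F 1 (τ (conePt (P y) y t))).comp (ContinuousLinearMap.id ℝ E - P) +
        (((curryLeftCLM F 1).flip (y - P y)).comp
          ((τ' (conePt (P y) y t)).comp (axisDiff P t)))) :=
    funext fun t ↦ axisDerivIntegrand_eq P τ τ' y t k
  rw [e]
  refine (continuousOn_pow k).smul (ContinuousOn.add ?_ ?_)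
  · exact ((curryLeftCLM F 1).continuous.comp_continuousOn
      (continuousOn_comp_conePt hc hstar hy)).clm_comp continuousOn_const
  · exact continuousOn_const.clm_comp ((continuousOn_comp_conePt hc' hstar hy).clm_comp
      (continuous_axisDiff P).continuousOn)

set_option maxHeartbeats 1600000 in
omit [CompleteSpace F] in
/-- **Differentiation under the integral sign** for `y ↦ ∫₀¹ tᵏ · τ(h_t y).curryLeft (y - P y) dt`
(`k = 0`: the `P`-part `A`; `k = 1`: the cone part with moving base point `P y`), at a point `y`
of an open convex set `X` with `P(X) ⊆ X` on which `τ` is `C¹` (`τ' = Dτ` continuous), granted a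
uniform bound of `τ`, `Dτ` on the segments over a ball at `y`. [cite: Spivak1965, Thm. 4-11] -/
theorem hasFDerivAt_axisIntegral {τ : E → E [⋀^Fin 2]→L[ℝ] F}
    {τ' : E → E →L[ℝ] E [⋀^Fin 2]→L[ℝ] F} {X : Set E} {P : E →L[ℝ] E} (hX : Convex ℝ X)
    (hP : ∀ y ∈ X, P y ∈ X) (hd : ∀ x ∈ X, HasFDerivAt τ (τ' x) x) (hc : ContinuousOn τ X)
    (hc' : ContinuousOn τ' X) {y : E} {r C : ℝ} (hr : 0 < r) (hball : Metric.ball y r ⊆ X)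
    (hC : ∀ y' ∈ Metric.ball y r, ∀ t ∈ Icc (0 : ℝ) 1,
      ‖τ (conePt (P y') y' t)‖ ≤ C ∧ ‖τ' (conePt (P y') y' t)‖ ≤ C) (k : ℕ) :
    HasFDerivAt (fun y' : E ↦ ∫ t in (0 : ℝ)..1, (t ^ k) • (τ (conePt (P y') y' t)).curryLeft (y' - P y'))
      (∫ t in (0 : ℝ)..1, axisDerivIntegrand P τ τ' y t k) y := by
  haveI : TopologicalSpace.PseudoMetrizableSpace (E →L[ℝ] E [⋀^Fin 1]→L[ℝ] F) :=
    pseudoMetrizableSpace_clm_alternating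
  have hy : y ∈ X := hball (Metric.mem_ball_self hr)
  have hyX : ∀ y' ∈ Metric.ball y r, y' ∈ X := fun y' hy' ↦ hball hy'
  have hst : ∀ y' ∈ Metric.ball y r, StarConvex ℝ (P y') X := fun y' hy' ↦
    starConvex_base hX hP (hyX y' hy')
  -- continuity of the integrands in `t` on `[0, 1]`
  have hFc : ∀ y' ∈ Metric.ball y r, ContinuousOn
      (fun t : ℝ ↦ (t ^ k) • (τ (conePt (P y') y' t)).curryLeft (y' - P y')) (Icc 0 1) :=
    fun y' hy' ↦ (continuousOn_pow k).smul (continuousOn_integrandA hc (hst y' hy') (hyX y' hy'))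
  have hF'c : ContinuousOn (fun t : ℝ ↦ axisDerivIntegrand P τ τ' y t k) (Icc 0 1) :=
    continuousOn_axisDerivIntegrand (hst y (Metric.mem_ball_self hr)) hy hc hc' k
  have hI : Ι (0 : ℝ) 1 = Ioc 0 1 := uIoc_of_le zero_le_one
  set Q : ℝ := ‖ContinuousLinearMap.id ℝ E - P‖ with hQ
  set B : ℝ := C * Q + C * (‖P‖ + Q) * (Q * (‖y‖ + r)) with hB
  refine intervalIntegral.hasFDerivAt_integral_of_dominated_of_fderiv_le (μ := volume)
    (F := fun (y' : E) (t : ℝ) ↦ (t ^ k) • (τ (conePt (P y') y' t)).curryLeft (y' - P y'))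
    (F' := fun (y' : E) (t : ℝ) ↦ axisDerivIntegrand P τ τ' y' t k) (bound := fun _ ↦ B)
    (Metric.ball_mem_nhds y hr) ?_ ?_ ?_ ?_ intervalIntegrable_const ?_
  · filter_upwards [Metric.ball_mem_nhds y hr] with y' hy'
    rw [hI]
    exact ((hFc y' hy').mono Ioc_subset_Icc_self).aestronglyMeasurable measurableSet_Ioc
  · exact ContinuousOn.intervalIntegrable (by
      rw [uIcc_of_le zero_le_one]; exact hFc y (Metric.mem_ball_self hr))
  · rw [hI]
    exact (hF'c.mono Ioc_subset_Icc_self).aestronglyMeasurable measurableSet_Ioc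
  · refine Filter.Eventually.of_forall fun t ht y' hy' ↦ ?_
    rw [hI] at ht
    have ht' : t ∈ Icc (0 : ℝ) 1 := ⟨ht.1.le, ht.2⟩
    obtain ⟨hτC, hτ'C⟩ := hC y' hy' t ht'
    have h0C : 0 ≤ C := (norm_nonneg _).trans hτC
    have hdist : ‖y' - P y'‖ ≤ Q * (‖y‖ + r) := by
      have h1 : ‖y' - P y'‖ ≤ Q * ‖y'‖ := by
        simpa [hQ] using (ContinuousLinearMap.id ℝ E - P).le_opNorm y'
      have h2 : ‖y'‖ ≤ ‖y‖ + r := by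
        have h3 : ‖y' - y‖ < r := by rwa [← dist_eq_norm]
        linarith [norm_le_norm_add_norm_sub' y' y, norm_sub_rev y' y]
      exact h1.trans (mul_le_mul_of_nonneg_left h2 (norm_nonneg _))
    calc ‖axisDerivIntegrand P τ τ' y' t k‖
        ≤ ‖τ (conePt (P y') y' t)‖ * Q + ‖τ' (conePt (P y') y' t)‖ * (‖P‖ + Q) * ‖y' - P y'‖ :=
          norm_axisDerivIntegrand_le P τ τ' y' ht' k
      _ ≤ C * Q + C * (‖P‖ + Q) * (Q * (‖y‖ + r)) := by
          gcongr
  · refine Filter.Eventually.of_forall fun t ht y' hy' ↦ ?_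
    rw [hI] at ht
    exact hasFDerivAt_axisIntegrand (hd _ (conePt_mem (hst y' hy') (hyX y' hy') ⟨ht.1.le, ht.2⟩)) k

omit [CompleteSpace F] in
/-- **The `P`-part `A` is differentiable**, derivative `∫₀¹ F'(y, t, k = 0) dt`.
[cite: Spivak1965, Thm. 4-11] -/
theorem hasFDerivAt_axisIntegralA {τ : E → E [⋀^Fin 2]→L[ℝ] F}
    {τ' : E → E →L[ℝ] E [⋀^Fin 2]→L[ℝ] F} {X : Set E} {P : E →L[ℝ] E} (hX : Convex ℝ X)
    (hP : ∀ y ∈ X, P y ∈ X) (hd : ∀ x ∈ X, HasFDerivAt τ (τ' x) x) (hc : ContinuousOn τ X)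
    (hc' : ContinuousOn τ' X) {y : E} {r C : ℝ} (hr : 0 < r) (hball : Metric.ball y r ⊆ X)
    (hC : ∀ y' ∈ Metric.ball y r, ∀ t ∈ Icc (0 : ℝ) 1,
      ‖τ (conePt (P y') y' t)‖ ≤ C ∧ ‖τ' (conePt (P y') y' t)‖ ≤ C) :
    HasFDerivAt (axisIntegralA P τ) (∫ t in (0 : ℝ)..1, axisDerivIntegrand P τ τ' y t 0) y := by
  have h := hasFDerivAt_axisIntegral hX hP hd hc hc' hr hball hC 0
  simp only [pow_zero, one_smul] at h
  exact h

omit [CompleteSpace F] in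
/-- **The cone part with moving base point `P y` is differentiable**, derivative
`∫₀¹ F'(y, t, k = 1) dt`. [cite: Spivak1965, Thm. 4-11] -/
theorem hasFDerivAt_conePrimitive_base {τ : E → E [⋀^Fin 2]→L[ℝ] F}
    {τ' : E → E →L[ℝ] E [⋀^Fin 2]→L[ℝ] F} {X : Set E} {P : E →L[ℝ] E} (hX : Convex ℝ X)
    (hP : ∀ y ∈ X, P y ∈ X) (hd : ∀ x ∈ X, HasFDerivAt τ (τ' x) x) (hc : ContinuousOn τ X)
    (hc' : ContinuousOn τ' X) {y : E} {r C : ℝ} (hr : 0 < r) (hball : Metric.ball y r ⊆ X)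
    (hC : ∀ y' ∈ Metric.ball y r, ∀ t ∈ Icc (0 : ℝ) 1,
      ‖τ (conePt (P y') y' t)‖ ≤ C ∧ ‖τ' (conePt (P y') y' t)‖ ≤ C) :
    HasFDerivAt (fun y' : E ↦ conePrimitive (P y') τ y')
      (∫ t in (0 : ℝ)..1, axisDerivIntegrand P τ τ' y t 1) y := by
  have h := hasFDerivAt_axisIntegral hX hP hd hc hc' hr hball hC 1
  exact h

end Literature.Analysis.Calculus

end
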